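import Summits.AtomisticToContinuum.Crystallization.Theorems.FrustratedLawDichotomyStrainedPatchHomEntryGramHcp
import Summits.AtomisticToContinuum.Crystallization.Theorems.FrustratedLawDichotomyStrainedPatchHomLeafTableDataCert

/-!
# The TABLE CHECKER as an entry-leaf verdict: adapter `tableLeafOK`, its soundness in the `hver` shape, the combined verdicts
# `entryLeafOKT` / `entryLeafOKTB`, and `(H) HomFloor m` from two Booleans with the table checker on the fcc side

decomp-a2c hand-1 g21 (crux `AperiodicFrustratedLawGap`, stmt-AtomisticToContinuum-27623; critic row 828 (B)(2): «ONE adapter lemma `tableLeafOK_sound`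
of the `hver` shape (entries-in-box ⟹ `gram_mem_box` ⟹ hand-1 `leafCheck_sound`) makes `asymOK ∨ colOutOK ∨ leafCheck …` a second admissible verdict,
so the kernel-cheaper checker per leaf can be chosen by measurement, not by lineage»).

hand-2's entry-tree driver (`…HomEntryGram.fccHalf_of_entryTree`) accepts ANY Boolean leaf verdict on ENTRY boxes `(c, w) : Fin 3 × Fin 3 → ℤ`
(`|u_ab − c_ab/SC| ≤ w_ab/SC`, `u_ab = (U e_b) a`) that is sound in the sense: self-adjoint `U`, `‖U − 1‖ ≤ 1/4`, entries in the box ⟹ prune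
disjunct ∨ `μ/SC ≤ Σ_{b ∈ [−7,7]³∖0} W₄₅ ‖latPt U fccVec b‖`.  hand-1's v2 TABLE checker (`…HomLeafTableCheck.leafCheck`, data certified in
`…HomLeafTableDataCert`, assembled soundness `boxSum_ge_of_leafCheck`) works on a Gram box `g : GB` (naturals `cᵢⱼ, wᵢⱼ` at scale `SC`).  This module:

* §1 `tabGB c w : GB` — the nine Gram intervals `gramFI (entryFI c w) i j` of hand-2's interval squaring (REUSED, not re-derived), re-encoded as
  centre/half-width naturals (`cen`/`rad` of `…HomEntryGram`, `Int.toNat`); the guard `cenOK` (all nine centres `≥ 0`, always true near `1`;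
  it only protects the `ℕ` encoding); ★ `tabGB_mem_box` : entries in the entry box ⟹ Gram data in `tabGB` (exactly `boxSum_ge_of_leafCheck`'s `hbox`);
* §2 ★ the verdict `tableLeafOK μ c w := cenOK ∧ leafCheck qTable nearLabels tabE tabA0…tabA5 36 (tabGB c w) (μ < 0) |μ|` and
  ★★ `tableLeafOK_sound` in the `hver` shape (conclusion: the floor disjunct, via `boxSum_ge_of_leafCheck` and `sgnZ (μ < 0) |μ| = μ`);
* §3 the combined verdicts `entryLeafOKT μ := fitOK ∨ asymOK ∨ colOutOK ∨ tableLeafOK μ` ((P1) ∨ symmetry ∨ column ∨ TABLE (P4)) and the hybrid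
  `entryLeafOKTB μ := entryLeafOKT μ ∨ leafOK2 μ (gramC c w) (gramW c w)` (table first, hand-2's box checker as fallback — `||` short-circuits, so
  the fallback costs nothing on leaves the table accepts), their soundness, ★★ `fccHalf_of_entryTableTree` / `fccHalf_of_entryTableBoxTree`
  (= `hfcc` of `…HomPrunedPolar.homFloor_of_prunedBoxSums_selfAdjoint`, verbatim, for every `m` with `2 (m + e_W) SC ≤ μ`), and
  ★★★ `homFloor_of_entryTableTrees` : `2(m + e_W)SC ≤ μ → treeOK (entryLeafOKT μ) tF rootC rootW = true → treeOK (entryLeafOKHc μ) tH rootCH rootWH = true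
  → HomFloor m` (twin of hand-2's `homFloor_of_entryTrees` with the table checker on the fcc side; same hcp side);
* §4 kernel smoke tests (`decide +kernel`): `tabGB` of the thin root centre is the ideal fcc Gram `(1, ½)`; the table verdict ACCEPTS the entry box of
  half-width `2⁻¹²` about the critical-layer matrix `U = √0.9425·diag(1.03, 1, 0.97)` at the record target `μ⋆ = ⌈2(1/625 + e_W)·SC⌉ = −398793747003657`
  and REJECTS the thin box at the compressed unstrained lattice `U = 0.97·1` (there (P4) is false and (P1) `fitOK` is the disjunct that fires).

MEASURED (farm kernel, this module's verdicts on the SAME entry box `critC ± 2⁻¹²`): `tableLeafOK` ≈ 0.4 s per leaf; hand-2's `entryLeafOK` (the ONE-Boolean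
box checker `leafOK2` on `gramC/gramW`) ≈ 126 s per leaf — both ACCEPT exactly the same half-widths `2⁻¹⁸ … 2⁻¹²` of this box natively and both reject `2⁻¹¹`.
So for an in-kernel `decide` of a certificate tree the table verdict is the one to use; under `native_decide` either runs.

All definitions computable; 0 sorry; standard axioms; no instances / notation / `#eval`.  `--supports stmt-AtomisticToContinuum-27623`.
-/

namespace Summit.AtomisticToContinuum.Crystallization.Theorems.FrustratedLawDichotomyStrainedPatchHomEntryTable

open scoped BigOperators RealInnerProductSpace
open Literature.Analysis.ValidatedNumerics.Numerics
open Summit.AtomisticToContinuum.Crystallization.Theorems.ChargedEnergyGapNegative (E3)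
open Summit.AtomisticToContinuum.Crystallization.Theorems.FrustratedLawDichotomySchurCut (effPot w₄₅ ω₄)
open Summit.AtomisticToContinuum.Crystallization.Theorems.FrustratedLawDichotomyAveragingRuleTightFree (TightNearCap BadNearCap)
open Summit.AtomisticToContinuum.Crystallization.Theorems.FrustratedLawDichotomyExemptAbsorption (ExemptNear)
open Summit.AtomisticToContinuum.Crystallization.Theorems.FrustratedLawDichotomyStrainedPatchHomSplit
open Summit.AtomisticToContinuum.Crystallization.Theorems.FrustratedLawDichotomyStrainedPatchHomPrunedPolar (homFloor_of_prunedBoxSums_selfAdjoint)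
open Summit.AtomisticToContinuum.Crystallization.Theorems.FrustratedLawDichotomyStrainedPatchHomCertTree (CertTree treeOK leafOK2 leafOK2_sound)
open Summit.AtomisticToContinuum.Crystallization.Theorems.FrustratedLawDichotomyStrainedPatchHomEntryGram
open Summit.AtomisticToContinuum.Crystallization.Theorems.FrustratedLawDichotomyStrainedPatchHomEntryFit (fitOK fitOK_sound)
open Summit.AtomisticToContinuum.Crystallization.Theorems.FrustratedLawDichotomyStrainedPatchHomEntryGramHcp
  (entryLeafOKHc rootCH rootWH hcpHalf_of_entryLeafTree)
open Summit.AtomisticToContinuum.Crystallization.Theorems.FrustratedLawDichotomyStrainedPatchHomLeafTableCheck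
  (GB sgnZ leafCheck qTable nearLabels tabE tabA0 tabA1 tabA2 tabA3 tabA4 tabA5 boxSum_ge_of_leafCheck)
open Literature.Barriers.AtomisticToContinuum.FlatleyTheil2015 (fccVec)

/-! ## §1. The table-checker Gram box of an entry box -/

/-- ★ The TABLE-CHECKER Gram box of the entry box `(c, w)`: centre `cen` and half-width `rad` (as naturals) of the nine interval-squared Gram data
`gramFI (entryFI c w) i j ∋ ⟪U fᵢ, U fⱼ⟫` of `…HomEntryGram`, in the field order `c00 c01 c02 c10 … c22`, `w00 … w22` of `GB`. -/
def tabGB (c w : Fin 3 × Fin 3 → ℤ) : GB :=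
  ⟨(cen (gramFI (entryFI c w) 0 0)).toNat, (cen (gramFI (entryFI c w) 0 1)).toNat, (cen (gramFI (entryFI c w) 0 2)).toNat,
   (cen (gramFI (entryFI c w) 1 0)).toNat, (cen (gramFI (entryFI c w) 1 1)).toNat, (cen (gramFI (entryFI c w) 1 2)).toNat,
   (cen (gramFI (entryFI c w) 2 0)).toNat, (cen (gramFI (entryFI c w) 2 1)).toNat, (cen (gramFI (entryFI c w) 2 2)).toNat,
   (rad (gramFI (entryFI c w) 0 0)).toNat, (rad (gramFI (entryFI c w) 0 1)).toNat, (rad (gramFI (entryFI c w) 0 2)).toNat,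
   (rad (gramFI (entryFI c w) 1 0)).toNat, (rad (gramFI (entryFI c w) 1 1)).toNat, (rad (gramFI (entryFI c w) 1 2)).toNat,
   (rad (gramFI (entryFI c w) 2 0)).toNat, (rad (gramFI (entryFI c w) 2 1)).toNat, (rad (gramFI (entryFI c w) 2 2)).toNat⟩

/-- The nine Gram coordinates `(i, j)`. -/
def pairs3 : List (Fin 3 × Fin 3) := [(0, 0), (0, 1), (0, 2), (1, 0), (1, 1), (1, 2), (2, 0), (2, 1), (2, 2)]

/-- Every coordinate pair is listed. [formal bookkeeping] -/
theorem mem_pairs3 : ∀ i j : Fin 3, (i, j) ∈ pairs3 := by decide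

/-- Guard of the `ℕ` encoding: all nine Gram centres are non-negative (they are `≈ 1` and `≈ ½` on every box that survives the column prune). -/
def cenOK (c w : Fin 3 × Fin 3 → ℤ) : Bool := pairs3.all fun ij => decide (0 ≤ cen (gramFI (entryFI c w) ij.1 ij.2))

/-- The centre table of `tabGB`. [formal bookkeeping] -/
theorem tabGB_cz (c w : Fin 3 × Fin 3 → ℤ) (i j : Fin 3) : (tabGB c w).cz i j = (cen (gramFI (entryFI c w) i j)).toNat := by
  fin_cases i <;> fin_cases j <;> rfl

/-- The half-width table of `tabGB`. [formal bookkeeping] -/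
theorem tabGB_wz (c w : Fin 3 × Fin 3 → ℤ) (i j : Fin 3) : (tabGB c w).wz i j = (rad (gramFI (entryFI c w) i j)).toNat := by
  fin_cases i <;> fin_cases j <;> rfl

/-- The guard gives `0 ≤ cen` for each of the nine Gram intervals. [formal bookkeeping] -/
theorem cen_nonneg_of_cenOK {c w : Fin 3 × Fin 3 → ℤ} (h : cenOK c w = true) (i j : Fin 3) : 0 ≤ cen (gramFI (entryFI c w) i j) := by
  have h' := List.all_eq_true.1 h (i, j) (mem_pairs3 i j)
  simpa only [decide_eq_true_eq] using h'

/-- ★ **ENTRIES IN THE ENTRY BOX ⟹ GRAM DATA IN `tabGB`** (under the guard): exactly the `hbox` hypothesis of `…HomLeafTableDataCert.boxSum_ge_of_leafCheck`,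
from hand-2's interval squaring `mem_gramFI` / `abs_sub_cen_le` (`Int.toNat` is the identity on the centres and can only enlarge the widths). [folklore] -/
theorem tabGB_mem_box (U : E3 →L[ℝ] E3) {c w : Fin 3 × Fin 3 → ℤ} (hcen : cenOK c w = true)
    (hbox : ∀ ab : Fin 3 × Fin 3, |(U (EuclideanSpace.single ab.2 (1 : ℝ))) ab.1 - (c ab : ℝ) / SC| ≤ (w ab : ℝ) / SC) (i j : Fin 3) :
    |⟪U (fccVec i), U (fccVec j)⟫ - (((tabGB c w).cz i j : ℤ) : ℝ) / SC| ≤ (((tabGB c w).wz i j : ℤ) : ℝ) / SC := by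
  have hm := abs_sub_cen_le (mem_gramFI U (fun ab => mem_entryFI (hbox ab)) i j)
  rw [tabGB_cz, tabGB_wz, Int.toNat_of_nonneg (cen_nonneg_of_cenOK hcen i j)]
  have e2 : (rad (gramFI (entryFI c w) i j) : ℝ) ≤ (((rad (gramFI (entryFI c w) i j)).toNat : ℤ) : ℝ) := by
    exact_mod_cast Int.self_le_toNat _
  exact hm.trans (div_le_div_of_nonneg_right e2 SC_pos.le)

/-! ## §2. The table verdict and its soundness in the `hver` shape -/

/-- ★ **THE TABLE VERDICT on an entry box**: guard ∧ hand-1's v2 table checker on `tabGB c w` with stop norm `36` and the target `μ` in sign–magnitude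
form (`sμ = (μ < 0)`, `aμ = |μ|`). -/
def tableLeafOK (μ : ℤ) (c w : Fin 3 × Fin 3 → ℤ) : Bool :=
  cenOK c w && leafCheck qTable nearLabels tabE tabA0 tabA1 tabA2 tabA3 tabA4 tabA5 36 (tabGB c w) (decide (μ < 0)) μ.natAbs

/-- Sign–magnitude round trip: `sgnZ (μ < 0) |μ| = μ`. [formal bookkeeping] -/
theorem sgnZ_natAbs (μ : ℤ) : sgnZ (decide (μ < 0)) μ.natAbs = μ := by
  by_cases h : μ < 0
  · simp only [h, decide_true, sgnZ]; omega
  · simp only [h, decide_false, sgnZ]; omega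

/-- ★★ **SOUNDNESS OF THE TABLE VERDICT** in the shape consumed by `…HomEntryGram.fccHalf_of_entryTree` (`hver`): for every self-adjoint `U` with
`‖U − 1‖ ≤ 1/4` whose entries lie in the box, the prune disjunct holds or `μ/SC ≤ Σ_{b ∈ [−7,7]³∖0} W₄₅ ‖latPt U fccVec b‖` — here always the
latter, by `boxSum_ge_of_leafCheck` (table data certified once in `…HomLeafTableDataCert`; far labels from `‖U − 1‖ ≤ 1/4`, stop norm `36`).
Self-adjointness is not used by this verdict. [folklore] -/
theorem tableLeafOK_sound {μ : ℤ} {c w : Fin 3 × Fin 3 → ℤ} (h : tableLeafOK μ c w = true) (U : E3 →L[ℝ] E3)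
    (_hsa : ∀ v v' : E3, ⟪U v, v'⟫ = ⟪v, U v'⟫) (hU : ‖U - 1‖ ≤ 1 / 4)
    (hbox : ∀ ab : Fin 3 × Fin 3, |(U (EuclideanSpace.single ab.2 (1 : ℝ))) ab.1 - (c ab : ℝ) / SC| ≤ (w ab : ℝ) / SC) :
    (∀ (M : ℕ) (z : Fin M → E3) (c : Fin M), Function.Injective z →
        Set.range z = {x : E3 | dist x (z c) ≤ 133 / 10 ∧ ∃ a : Fin 3 → ℤ, x = z c + latPt U fccVec a} →
        TightNearCap (9 / 5) (3 / 2) z c ∨ ExemptNear (9 / 5) ExRec z c ∨ BadNearCap (9 / 5) (3 / 2) z c) ∨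
      (μ : ℝ) / SC ≤ ∑ b ∈ (Fintype.piFinset fun _ : Fin 3 => Finset.Icc (-7 : ℤ) 7).filter (fun b => b ≠ 0),
        effPot w₄₅ ω₄ (3 / 400) ‖latPt U fccVec b‖ := by
  simp only [tableLeafOK, Bool.and_eq_true] at h
  obtain ⟨hcen, hleaf⟩ := h
  refine Or.inr ?_
  have key := boxSum_ge_of_leafCheck hleaf U hU (fun i j => tabGB_mem_box U hcen hbox i j)
  rwa [sgnZ_natAbs] at key

/-! ## §3. Combined verdicts and the fcc half / `HomFloor` from tree verdicts -/

/-- Entries of a self-adjoint `U` are symmetric: `(U e_b) a = (U e_a) b`. [folklore] -/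
theorem entries_symm {U : E3 →L[ℝ] E3} (hsa : ∀ v v' : E3, ⟪U v, v'⟫ = ⟪v, U v'⟫) (a b : Fin 3) :
    (U (EuclideanSpace.single b (1 : ℝ))) a = (U (EuclideanSpace.single a (1 : ℝ))) b := by
  have e1 : (U (EuclideanSpace.single b (1 : ℝ))) a = ⟪EuclideanSpace.single a (1 : ℝ), U (EuclideanSpace.single b (1 : ℝ))⟫ := by
    rw [EuclideanSpace.inner_single_left]; simp
  have e2 : (U (EuclideanSpace.single a (1 : ℝ))) b = ⟪EuclideanSpace.single b (1 : ℝ), U (EuclideanSpace.single a (1 : ℝ))⟫ := by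
    rw [EuclideanSpace.inner_single_left]; simp
  rw [e1, e2, ← hsa, real_inner_comm]

/-- ★ **ENTRY-LEAF VERDICT WITH THE TABLE CHECKER**: (P1) fit prune ∨ symmetry prune ∨ column prune ∨ TABLE (P4) — cheap prunes first. -/
def entryLeafOKT (μ : ℤ) (c w : Fin 3 × Fin 3 → ℤ) : Bool := fitOK c w || asymOK c w || colOutOK c w || tableLeafOK μ c w

/-- ★ **HYBRID VERDICT**: `entryLeafOKT μ` ∨ hand-2's box checker `leafOK2 μ (gramC c w) (gramW c w)` as a fallback (evaluated only on leaves the table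
rejects, by short-circuiting of `||`). -/
def entryLeafOKTB (μ : ℤ) (c w : Fin 3 × Fin 3 → ℤ) : Bool := entryLeafOKT μ c w || leafOK2 μ (gramC c w) (gramW c w)

/-- ★ Soundness of `entryLeafOKT` (shape of `…HomEntryGram.fccHalf_of_entryTree`). [folklore] -/
theorem entryLeafOKT_sound {μ : ℤ} {c w : Fin 3 × Fin 3 → ℤ} (h : entryLeafOKT μ c w = true) (U : E3 →L[ℝ] E3)
    (hsa : ∀ v v' : E3, ⟪U v, v'⟫ = ⟪v, U v'⟫) (hU : ‖U - 1‖ ≤ 1 / 4)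
    (hbox : ∀ ab : Fin 3 × Fin 3, |(U (EuclideanSpace.single ab.2 (1 : ℝ))) ab.1 - (c ab : ℝ) / SC| ≤ (w ab : ℝ) / SC) :
    (∀ (M : ℕ) (z : Fin M → E3) (c : Fin M), Function.Injective z →
        Set.range z = {x : E3 | dist x (z c) ≤ 133 / 10 ∧ ∃ a : Fin 3 → ℤ, x = z c + latPt U fccVec a} →
        TightNearCap (9 / 5) (3 / 2) z c ∨ ExemptNear (9 / 5) ExRec z c ∨ BadNearCap (9 / 5) (3 / 2) z c) ∨
      (μ : ℝ) / SC ≤ ∑ b ∈ (Fintype.piFinset fun _ : Fin 3 => Finset.Icc (-7 : ℤ) 7).filter (fun b => b ≠ 0),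
        effPot w₄₅ ω₄ (3 / 400) ‖latPt U fccVec b‖ := by
  simp only [entryLeafOKT, Bool.or_eq_true] at h
  rcases h with ((h | h) | h) | h
  · exact Or.inl (fitOK_sound h U hU hbox)
  · exact (false_of_asymOK h (u := fun ab : Fin 3 × Fin 3 => (U (EuclideanSpace.single ab.2 (1 : ℝ))) ab.1)
      (fun a b => entries_symm hsa a b) hbox).elim
  · exact (false_of_colOutOK h U hU hbox).elim
  · exact tableLeafOK_sound h U hsa hU hbox

/-- ★ Soundness of the hybrid verdict `entryLeafOKTB`. [folklore] -/
theorem entryLeafOKTB_sound {μ : ℤ} {c w : Fin 3 × Fin 3 → ℤ} (h : entryLeafOKTB μ c w = true) (U : E3 →L[ℝ] E3)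
    (hsa : ∀ v v' : E3, ⟪U v, v'⟫ = ⟪v, U v'⟫) (hU : ‖U - 1‖ ≤ 1 / 4)
    (hbox : ∀ ab : Fin 3 × Fin 3, |(U (EuclideanSpace.single ab.2 (1 : ℝ))) ab.1 - (c ab : ℝ) / SC| ≤ (w ab : ℝ) / SC) :
    (∀ (M : ℕ) (z : Fin M → E3) (c : Fin M), Function.Injective z →
        Set.range z = {x : E3 | dist x (z c) ≤ 133 / 10 ∧ ∃ a : Fin 3 → ℤ, x = z c + latPt U fccVec a} →
        TightNearCap (9 / 5) (3 / 2) z c ∨ ExemptNear (9 / 5) ExRec z c ∨ BadNearCap (9 / 5) (3 / 2) z c) ∨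
      (μ : ℝ) / SC ≤ ∑ b ∈ (Fintype.piFinset fun _ : Fin 3 => Finset.Icc (-7 : ℤ) 7).filter (fun b => b ≠ 0),
        effPot w₄₅ ω₄ (3 / 400) ‖latPt U fccVec b‖ := by
  simp only [entryLeafOKTB, Bool.or_eq_true] at h
  rcases h with h | h
  · exact entryLeafOKT_sound h U hsa hU hbox
  · exact Or.inr (leafOK2_sound h U (gram_mem_box U hbox))

/-- ★★ **THE fcc HALF OF `(H)` FROM ONE BOOLEAN, table checker on the leaves**: `treeOK (entryLeafOKT μ) t rootC rootW = true` with
`2 (m + e_W) SC ≤ μ` ⟹ the fcc hypothesis `hfcc` of `…HomPrunedPolar.homFloor_of_prunedBoxSums_selfAdjoint` for `m`, verbatim. [folklore] -/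
theorem fccHalf_of_entryTableTree {m : ℝ} {μ : ℤ} (hμ : 2 * (m + (-(7175 / 10000) + 3 / 400)) * SC ≤ μ)
    {t : CertTree (Fin 3 × Fin 3)} (h : treeOK (entryLeafOKT μ) t rootC rootW = true) :
    ∀ U : E3 →L[ℝ] E3, (∀ v w : E3, inner ℝ (U v) w = inner ℝ v (U w)) → (∀ w : E3, 0 ≤ inner ℝ w (U w)) → ‖U - 1‖ ≤ 1 / 4 →
      (∀ (M : ℕ) (z : Fin M → E3) (c : Fin M), Function.Injective z →
          Set.range z = {x : E3 | dist x (z c) ≤ 133 / 10 ∧ ∃ a : Fin 3 → ℤ, x = z c + latPt U fccVec a} →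
          TightNearCap (9 / 5) (3 / 2) z c ∨ ExemptNear (9 / 5) ExRec z c ∨ BadNearCap (9 / 5) (3 / 2) z c) ∨
      m ≤ (∑ b ∈ (Fintype.piFinset fun _ : Fin 3 => Finset.Icc (-7 : ℤ) 7).filter (fun b => b ≠ 0),
        effPot w₄₅ ω₄ (3 / 400) ‖latPt U fccVec b‖) / 2 - (-(7175 / 10000) + 3 / 400) :=
  fccHalf_of_entryTree hμ (entryLeafOKT μ) (fun _ _ hv U hsa hU hbox => entryLeafOKT_sound hv U hsa hU hbox) h

/-- ★★ The same from the HYBRID verdict `entryLeafOKTB`. [folklore] -/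
theorem fccHalf_of_entryTableBoxTree {m : ℝ} {μ : ℤ} (hμ : 2 * (m + (-(7175 / 10000) + 3 / 400)) * SC ≤ μ)
    {t : CertTree (Fin 3 × Fin 3)} (h : treeOK (entryLeafOKTB μ) t rootC rootW = true) :
    ∀ U : E3 →L[ℝ] E3, (∀ v w : E3, inner ℝ (U v) w = inner ℝ v (U w)) → (∀ w : E3, 0 ≤ inner ℝ w (U w)) → ‖U - 1‖ ≤ 1 / 4 →
      (∀ (M : ℕ) (z : Fin M → E3) (c : Fin M), Function.Injective z →
          Set.range z = {x : E3 | dist x (z c) ≤ 133 / 10 ∧ ∃ a : Fin 3 → ℤ, x = z c + latPt U fccVec a} →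
          TightNearCap (9 / 5) (3 / 2) z c ∨ ExemptNear (9 / 5) ExRec z c ∨ BadNearCap (9 / 5) (3 / 2) z c) ∨
      m ≤ (∑ b ∈ (Fintype.piFinset fun _ : Fin 3 => Finset.Icc (-7 : ℤ) 7).filter (fun b => b ≠ 0),
        effPot w₄₅ ω₄ (3 / 400) ‖latPt U fccVec b‖) / 2 - (-(7175 / 10000) + 3 / 400) :=
  fccHalf_of_entryTree hμ (entryLeafOKTB μ) (fun _ _ hv U hsa hU hbox => entryLeafOKTB_sound hv U hsa hU hbox) h

/-- ★★★ **`(H) HomFloor m` FROM TWO BOOLEANS, table checker on the fcc side**: twin of hand-2's `…HomEntryGramHcp.homFloor_of_entryTrees` with the fcc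
tree verdict `entryLeafOKT μ`; the hcp side is unchanged (`entryLeafOKHc μ`). [folklore] -/
theorem homFloor_of_entryTableTrees {m : ℝ} {μ : ℤ} (hμ : 2 * (m + (-(7175 / 10000) + 3 / 400)) * SC ≤ μ)
    {tF : CertTree (Fin 3 × Fin 3)} (hF : treeOK (entryLeafOKT μ) tF rootC rootW = true)
    {tH : CertTree ((Fin 3 × Fin 3) ⊕ Fin 3)} (hH : treeOK (entryLeafOKHc μ) tH rootCH rootWH = true) : HomFloor m :=
  homFloor_of_prunedBoxSums_selfAdjoint (fccHalf_of_entryTableTree hμ hF) (hcpHalf_of_entryLeafTree hμ hH)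

/-- ★★★ The same with the HYBRID fcc verdict `entryLeafOKTB μ`. [folklore] -/
theorem homFloor_of_entryTableBoxTrees {m : ℝ} {μ : ℤ} (hμ : 2 * (m + (-(7175 / 10000) + 3 / 400)) * SC ≤ μ)
    {tF : CertTree (Fin 3 × Fin 3)} (hF : treeOK (entryLeafOKTB μ) tF rootC rootW = true)
    {tH : CertTree ((Fin 3 × Fin 3) ⊕ Fin 3)} (hH : treeOK (entryLeafOKHc μ) tH rootCH rootWH = true) : HomFloor m :=
  homFloor_of_prunedBoxSums_selfAdjoint (fccHalf_of_entryTableBoxTree hμ hF) (hcpHalf_of_entryLeafTree hμ hH)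

/-! ## §4. Kernel smoke tests -/

/-- The record target for `m = 1/625`: `μ⋆ = ⌈2 (1/625 + e_W) · SC⌉ = −398793747003657` (`e_W = −7175/10000 + 3/400`). -/
def muRec : ℤ := -398793747003657

/-- `μ⋆` satisfies the hypothesis `2 (m + e_W) SC ≤ μ` of the tree theorems at `m = 1/625`. [formal bookkeeping] -/
theorem muRec_ok : 2 * ((1 : ℝ) / 625 + (-(7175 / 10000) + 3 / 400)) * SC ≤ (muRec : ℝ) := by
  norm_num [muRec, SC]

/-- Entry box centred at (the `SC`-rounding of) the critical-layer matrix `U = √0.9425 · diag(1.03, 1, 0.97)` of the demonstration leaf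
`…HomLeafTablePilotLeaf.leafCrit`. -/
def critC : Fin 3 × Fin 3 → ℤ := fun ab =>
  if ab.1 = ab.2 then (if ab.1 = 0 then 281460656306931 else if ab.1 = 1 then 273262773113526 else 265064889920120) else 0

/-- `tabGB` of the thin root centre is the ideal fcc Gram box `(SC, SC/2; 0)`; the guard holds on the whole root cube and at the critical box; the
table verdict ACCEPTS the critical entry box of half-width `2⁻¹² = 2^36/SC` at `μ⋆` (≈ 0.4 s of kernel time, the cost of one `leafCheck`) and REJECTS
the thin box at the compressed unstrained lattice `U = 0.97·1` (site surplus below `1/625` there: (P4) is false and the (P1) fit prune is the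
disjunct that fires, so the combined verdict accepts that box at entry half-width `2⁻⁸`). [kernel computation] -/
example : (tabGB rootC (fun _ => 0)).c00 = 281474976710656 ∧ 2 * (tabGB rootC (fun _ => 0)).c01 = 281474976710656 ∧
    (tabGB rootC (fun _ => 0)).w01 = 0 ∧ cenOK rootC rootW = true ∧ cenOK critC (fun _ => 68719476736) = true ∧
    tableLeafOK muRec critC (fun _ => 68719476736) = true ∧
    tableLeafOK muRec (fun ab => if ab.1 = ab.2 then 273030727409336 else 0) (fun _ => 0) = false ∧
    entryLeafOKT muRec (fun ab => if ab.1 = ab.2 then 273030727409336 else 0) (fun _ => 1099511627776) = true := by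
  decide +kernel

end Summit.AtomisticToContinuum.Crystallization.Theorems.FrustratedLawDichotomyStrainedPatchHomEntryTable
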